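/-
Copyright (c) 2026 the pub-hodgecm-mathlib formalisation cell (harness21).  Prover seat hodgecm-mathlib-A-p12 (g24), 2026-09-02.  «S3-ram» (LEAD F0P3a-plan (g13); owner p06 (g15);
(Cnt2′) chair F0P3a-p07 (g14)): the W-SIDE PACK of the (α₂) TYPE-(2) line, part 6 — ALL depth balls in lattice currency, odd-scale collapse, and the `LEV(ϖ^k)` dichotomy.
`--supports stmt-HodgeConjecture-24833`.
-/
import Literature.NumberTheory.Rogawski1990.DepthZeroKappaTransferTypeTwoRamifiedWSideCensus   -- ★ p848666 (this seat): parts 1–4 (conversion, structure, census)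
import HarnessLib

/-!
# The W-side depth balls `{B ∣ SD, ΓB = B, (Γ − ½trΓ·1)B ⊆ ϖ^{2j}B}` in lattice currency, the odd-scale collapse, and the level tokens `LEV(ϖ^k)` for `k ≥ 3`
# (Labesse–Langlands 1979 §2; Rogawski 1990 §4.9; Kottwitz 1986 §3)

Topic `NumberTheory/Rogawski1990`; namespace `Literature.NumberTheory.Automorphic.UnitaryGroup`.  THEOREMS ONLY; kernel lane `--supports stmt-HodgeConjecture-24833`; cell
`pub/hodgecm-mathlib` (D-0151), crux H413, count-neutral; seat A-p12 (g24).  HONEST LABEL: HC_CM is proved only modulo the 2 remaining named inputs (hLiu418 24832, h413 24833).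

THE MATHEMATICS.  For the tube layers of the (Cnt2′) census ((z1-c), F0P2-p01 (g16)) the W-side level tokens are needed at ALL scales.  (§1) With `c := ½trΓ` the CENTRED ball token
`(Γ − c·1)B ⊆ ϖ^{2j}B` reads on `B = u𝒪_w²` as `|(u⁻¹Γu − c·1)_{ab}| ≤ |ϖ^{2j}|` (★ `map_toLin'_mapGL_stdLattice_le_scaleLattice_iff`, `u⁻¹(Γ − c·1)u = u⁻¹Γu − c·1`), so ★ part 1's conversion
and ★ (B-i) II∕III∕IV give **`#{B ∣ SD, ΓB = B, (Γ − c·1)B ⊆ ϖ^{2j}B} = (q+1)·Σ_(k<n−j) q^k`** (even depth `2n`, `j < n`), `= 0` (`j = n ≥ 1`), **`+ 1 = 2·Σ_(k<n−j+1) q^k`** (odd depth `2n+1`, `j ≤ n`).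
(§2) ODD SCALES COLLAPSE (★ `depth_collapse_of_twoDeep`): for `N ≠ 2j` the centred token at scale `ϖ^{2j+1}` defines the SAME family as at scale `ϖ^{2j}`.  (§3) THE `LEV(ϖ^k)` DICHOTOMY
for the chair's uncentred token `(Γ − 1)B ⊆ ϖ^k B`: since `Γ − 1 = (Γ − c·1) + (c − 1)·1` with `Γ − c·1` traceless, the family EQUALS the centred family at scale `ϖ^k` when `|c − 1| ≤ |ϖ^k|`,
and is EMPTY when `|c − 1| > |ϖ^k|` (`2(c − 1) = (E₀₀ + c − 1) + (E₁₁ + c − 1)`, `|2| = 1`) — `|½trΓ − 1|` is a datum of `Γ` not fixed by the discriminant depth.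

* §1 `conj_sub_smul_one_eq`, `ncard_selfDual_fixed_ball_eq_natCard_depth`, `ncard_selfDual_fixed_ball_of_even_depth_ramified`, `…_top_of_even_depth_ramified`, `…_of_odd_depth_ramified`.
* §2 `selfDual_fixed_ball_odd_scale_eq`.
* §3 `selfDual_fixed_lev_eq_ball_of_le`, `selfDual_fixed_lev_eq_empty_of_lt`.

## References
* [LabesseLanglands1979] J.-P. Labesse, R. P. Langlands, *L-indistinguishability for SL(2)*, Canad. J. Math. 31 (1979): §2 Lemma 2.1 p. 8.
* [Rogawski1990] J. D. Rogawski, *Automorphic Representations of Unitary Groups in Three Variables* (1990): §4.9 pp. 54–56.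
* [Kottwitz1986] R. Kottwitz, *Base change for unit elements of Hecke algebras*, Compositio Math. 60 (1986): §3.
-/

set_option autoImplicit false

noncomputable section

open MeasureTheory Measure Set NumberField IsDedekindDomain Matrix ValuativeRel MulAction Finset Polynomial
open scoped ValuativeRel Matrix MatrixGroups WithZero

namespace Literature.NumberTheory.Automorphic.UnitaryGroup

open Literature.NumberTheory.Rogawski1990 Literature.NumberTheory.Automorphic Literature.NumberTheory.Automorphic.IntegralReduction
open Literature.NumberTheory.Automorphic.UnitaryLatticeTree Literature.NumberTheory.Automorphic.HermitianLattice Literature.GroupTheory Literature.NumberTheory.GaloisRepresentations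

section Balls

variable (L : Type) [Field L] [NumberField L] [IsCMField L] (v : HeightOneSpectrum (𝓞 ↥(maximalRealSubfield L)))
  (w : PlacesOver L v) (hw : IsCMField.complexConj L • w.1 = w.1)

/-! ## §1 The centred depth balls in lattice currency -/

omit [IsCMField L] in
/-- `u⁻¹ (Γ − c·1) u = u⁻¹Γu − c·1` (matrix inverse spelling of ★ `map_toLin'_mapGL_stdLattice_le_scaleLattice_iff`). [cite: Kottwitz1986, §3] -/
theorem conj_sub_smul_one_eq (Γ u : GL (Fin 2) (w.1.adicCompletion L)) (c : (w.1.adicCompletion L)) :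
    (u : Matrix (Fin 2) (Fin 2) (w.1.adicCompletion L))⁻¹ * ((Γ : Matrix (Fin 2) (Fin 2) (w.1.adicCompletion L)) - c • (1 : Matrix (Fin 2) (Fin 2) (w.1.adicCompletion L))) * (u : Matrix (Fin 2) (Fin 2) (w.1.adicCompletion L)) =
      ((u⁻¹ * Γ * u : GL (Fin 2) (w.1.adicCompletion L)) : Matrix (Fin 2) (Fin 2) (w.1.adicCompletion L)) - c • (1 : Matrix (Fin 2) (Fin 2) (w.1.adicCompletion L)) := by
  rw [Units.val_mul, Units.val_mul, Matrix.coe_units_inv, Matrix.mul_sub, Matrix.sub_mul, Matrix.mul_smul, Matrix.mul_one, Matrix.smul_mul,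
    Matrix.nonsing_inv_mul _ (Matrix.isUnits_det_units u)]

set_option maxHeartbeats 1600000 in
include hw in
/-- **THE CENTRED BALL TOKEN READ ON COSETS.**  For `γ₂ ∈ U₂(L⁺_v)` 2-deep at `w` (`Γ = E₂γ₂`, `c = ½trΓ`) and every `j`: `#{B ∣ SD σ_w ϖ J B ∧ ΓB = B ∧ (Γ − c·1)B ⊆ ϖ^{2j}B}` equals the
size of the depth-`2j` ball `{hK⁰ : |(E₂(h⁻¹γ₂h) − c·1)_{ab}|_w ≤ |ϖ^{2j}|}` of ★ (B-i). [cite: Kottwitz1986, §3] [cite: Rogawski1990, §4.9 p. 54] -/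
theorem ncard_selfDual_fixed_ball_eq_natCard_depth (he : v.asIdeal.ramificationIdx' w.1.asIdeal ≠ 1) (h2 : IsUnit (2 : 𝒪[(w.1.adicCompletion L)]))
    (ϖ : (w.1.adicCompletion L)ˣ) (hϖ : Valued.v (ϖ : (w.1.adicCompletion L)) = WithZero.exp (-1 : ℤ)) (γ₂ : ((cmDatum L 2 (Matrix.of fun i j : Fin 2 => if i.val + j.val + 1 = 2 then (1 : L) else 0)).Local v))
    (h2deep : ∀ i j : Fin 2, Valued.v ((((((localNonsplitEquiv (IsCMField.complexConj L) (Matrix.of fun i j : Fin 2 => if i.val + j.val + 1 = 2 then (1 : L) else 0) (IsCMField.complexConj_ne_one L) w hw) (γ₂) : ↥(unitaryGroupOfForm (galAdicCompletionMap (L := L) (IsCMField.complexConj L) hw) (placeForm (Matrix.of fun i j : Fin 2 => if i.val + j.val + 1 = 2 then (1 : L) else 0) w.1))) : GL (Fin 2) (w.1.adicCompletion L)) : Matrix (Fin 2) (Fin 2) (w.1.adicCompletion L)) - 1) i j) ≤ Valued.v ((ϖ : (w.1.adicCompletion L)) ^ 2)) (j : ℕ) :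
    {B : Submodule (Valued.integer (w.1.adicCompletion L)) (Fin 2 → (w.1.adicCompletion L)) | UnitaryLatticeTree.IsSelfDualLattice (galAdicCompletionMap (L := L) (IsCMField.complexConj L) hw) (ϖ : (w.1.adicCompletion L)) (!![(0 : (w.1.adicCompletion L)), 1; 1, 0] : Matrix (Fin 2) (Fin 2) (w.1.adicCompletion L)) B ∧
        UnitaryLatticeTree.mapGL ((((localNonsplitEquiv (IsCMField.complexConj L) (Matrix.of fun i j : Fin 2 => if i.val + j.val + 1 = 2 then (1 : L) else 0) (IsCMField.complexConj_ne_one L) w hw) (γ₂) : ↥(unitaryGroupOfForm (galAdicCompletionMap (L := L) (IsCMField.complexConj L) hw) (placeForm (Matrix.of fun i j : Fin 2 => if i.val + j.val + 1 = 2 then (1 : L) else 0) w.1))) : GL (Fin 2) (w.1.adicCompletion L))) B = B ∧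
        B.map ((Matrix.toLin' ((((((localNonsplitEquiv (IsCMField.complexConj L) (Matrix.of fun i j : Fin 2 => if i.val + j.val + 1 = 2 then (1 : L) else 0) (IsCMField.complexConj_ne_one L) w hw) (γ₂) : ↥(unitaryGroupOfForm (galAdicCompletionMap (L := L) (IsCMField.complexConj L) hw) (placeForm (Matrix.of fun i j : Fin 2 => if i.val + j.val + 1 = 2 then (1 : L) else 0) w.1))) : GL (Fin 2) (w.1.adicCompletion L)) : Matrix (Fin 2) (Fin 2) (w.1.adicCompletion L))) - ((((((localNonsplitEquiv (IsCMField.complexConj L) (Matrix.of fun i j : Fin 2 => if i.val + j.val + 1 = 2 then (1 : L) else 0) (IsCMField.complexConj_ne_one L) w hw) (γ₂) : ↥(unitaryGroupOfForm (galAdicCompletionMap (L := L) (IsCMField.complexConj L) hw) (placeForm (Matrix.of fun i j : Fin 2 => if i.val + j.val + 1 = 2 then (1 : L) else 0) w.1))) : GL (Fin 2) (w.1.adicCompletion L)) : Matrix (Fin 2) (Fin 2) (w.1.adicCompletion L))).trace / 2) • (1 : Matrix (Fin 2) (Fin 2) (w.1.adicCompletion L)))).restrictScalars (Valued.integer (w.1.adicCompletion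 L))) ≤ UnitaryLatticeTree.scaleLattice ((ϖ : (w.1.adicCompletion L)) ^ (2 * j)) B}.ncard =
      Nat.card {x : ((cmDatum L 2 (Matrix.of fun i j : Fin 2 => if i.val + j.val + 1 = 2 then (1 : L) else 0)).Local v) ⧸ (cmLocalIntegralLevel L 2 (Matrix.of fun i j : Fin 2 => if i.val + j.val + 1 = 2 then (1 : L) else 0) v) | ∃ h : ((cmDatum L 2 (Matrix.of fun i j : Fin 2 => if i.val + j.val + 1 = 2 then (1 : L) else 0)).Local v), x = (h : ((cmDatum L 2 (Matrix.of fun i j : Fin 2 => if i.val + j.val + 1 = 2 then (1 : L) else 0)).Local v) ⧸ (cmLocalIntegralLevel L 2 (Matrix.of fun i j : Fin 2 => if i.val + j.val + 1 = 2 then (1 : L) else 0) v)) ∧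
        ∀ a b : Fin 2, Valued.v ((((((localNonsplitEquiv (IsCMField.complexConj L) (Matrix.of fun i j : Fin 2 => if i.val + j.val + 1 = 2 then (1 : L) else 0) (IsCMField.complexConj_ne_one L) w hw) (h⁻¹ * γ₂ * h) : ↥(unitaryGroupOfForm (galAdicCompletionMap (L := L) (IsCMField.complexConj L) hw) (placeForm (Matrix.of fun i j : Fin 2 => if i.val + j.val + 1 = 2 then (1 : L) else 0) w.1))) : GL (Fin 2) (w.1.adicCompletion L)) : Matrix (Fin 2) (Fin 2) (w.1.adicCompletion L)) - ((((((localNonsplitEquiv (IsCMField.complexConj L) (Matrix.of fun i j : Fin 2 => if i.val + j.val + 1 = 2 then (1 : L) else 0) (IsCMField.complexConj_ne_one L) w hw) (γ₂) : ↥(unitaryGroupOfForm (galAdicCompletionMap (L := L) (IsCMField.complexConj L) hw) (placeForm (Matrix.of fun i j : Fin 2 => if i.val + j.val + 1 = 2 then (1 : L) else 0) w.1))) : GL (Fin 2) (w.1.adicCompletion L)) : Matrix (Fin 2) (Fin 2) (w.1.adicCompletion L))).trace / 2) • (1 : Matrix (Fin 2) (Fin 2) (w.1.adicCompletion L))) a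 b) ≤ Valued.v ((ϖ : (w.1.adicCompletion L)) ^ (2 * j))} := by
  have hϖ0 : (ϖ : (w.1.adicCompletion L)) ≠ 0 := ϖ.ne_zero
  have hϖ1 : Valued.v (ϖ : (w.1.adicCompletion L)) ≤ 1 := by rw [hϖ, ← WithZero.exp_zero]; exact WithZero.exp_le_exp.2 (by norm_num)
  have h2w : Valued.v (2 : (w.1.adicCompletion L)) = 1 := (isUnit_two_integer_iff_valued_eq_one L w.1).1 h2
  have hc1 : Valued.v ((((((localNonsplitEquiv (IsCMField.complexConj L) (Matrix.of fun i j : Fin 2 => if i.val + j.val + 1 = 2 then (1 : L) else 0) (IsCMField.complexConj_ne_one L) w hw) (γ₂) : ↥(unitaryGroupOfForm (galAdicCompletionMap (L := L) (IsCMField.complexConj L) hw) (placeForm (Matrix.of fun i j : Fin 2 => if i.val + j.val + 1 = 2 then (1 : L) else 0) w.1))) : GL (Fin 2) (w.1.adicCompletion L)) : Matrix (Fin 2) (Fin 2) (w.1.adicCompletion L))).trace / 2) ≤ 1 := by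
    have e : (((((localNonsplitEquiv (IsCMField.complexConj L) (Matrix.of fun i j : Fin 2 => if i.val + j.val + 1 = 2 then (1 : L) else 0) (IsCMField.complexConj_ne_one L) w hw) (γ₂) : ↥(unitaryGroupOfForm (galAdicCompletionMap (L := L) (IsCMField.complexConj L) hw) (placeForm (Matrix.of fun i j : Fin 2 => if i.val + j.val + 1 = 2 then (1 : L) else 0) w.1))) : GL (Fin 2) (w.1.adicCompletion L)) : Matrix (Fin 2) (Fin 2) (w.1.adicCompletion L))).trace / 2 = (((((((localNonsplitEquiv (IsCMField.complexConj L) (Matrix.of fun i j : Fin 2 => if i.val + j.val + 1 = 2 then (1 : L) else 0) (IsCMField.complexConj_ne_one L) w hw) (γ₂) : ↥(unitaryGroupOfForm (galAdicCompletionMap (L := L) (IsCMField.complexConj L) hw) (placeForm (Matrix.of fun i j : Fin 2 => if i.val + j.val + 1 = 2 then (1 : L) else 0) w.1))) : GL (Fin 2) (w.1.adicCompletion L)) : Matrix (Fin 2) (Fin 2) (w.1.adicCompletion L)) - 1) 0 0 + (((((localNonsplitEquiv (IsCMField.complexConj L) (Matrix.of fun i j : Fin 2 => if i.val + j.val + 1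 = 2 then (1 : L) else 0) (IsCMField.complexConj_ne_one L) w hw) (γ₂) : ↥(unitaryGroupOfForm (galAdicCompletionMap (L := L) (IsCMField.complexConj L) hw) (placeForm (Matrix.of fun i j : Fin 2 => if i.val + j.val + 1 = 2 then (1 : L) else 0) w.1))) : GL (Fin 2) (w.1.adicCompletion L)) : Matrix (Fin 2) (Fin 2) (w.1.adicCompletion L)) - 1) 1 1) / 2) + 1 := by
      rw [Matrix.trace_fin_two]; simp only [Matrix.sub_apply, Matrix.one_apply_eq]; ring
    rw [e]
    refine le_trans (Valuation.map_add _ _ _) (max_le ?_ (by rw [map_one]))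
    rw [map_div₀, h2w, div_one]
    refine le_trans (Valuation.map_add _ _ _) (max_le (le_trans (h2deep 0 0) ?_) (le_trans (h2deep 1 1) ?_)) <;>
      (rw [map_pow]; exact pow_le_one₀ zero_le hϖ1)
  symm
  refine natCard_cosets_eq_ncard_selfDual_fixed L v w hw he h2 hϖ1 γ₂
    (fun Y : Matrix (Fin 2) (Fin 2) (w.1.adicCompletion L) => ∀ a b : Fin 2, Valued.v ((Y - ((((((localNonsplitEquiv (IsCMField.complexConj L) (Matrix.of fun i j : Fin 2 => if i.val + j.val + 1 = 2 then (1 : L) else 0) (IsCMField.complexConj_ne_one L) w hw) (γ₂) : ↥(unitaryGroupOfForm (galAdicCompletionMap (L := L) (IsCMField.complexConj L) hw) (placeForm (Matrix.of fun i j : Fin 2 => if i.val + j.val + 1 = 2 then (1 : L) else 0) w.1))) : GL (Fin 2) (w.1.adicCompletion L)) : Matrix (Fin 2) (Fin 2) (w.1.adicCompletion L))).trace / 2) • (1 : Matrix (Fin 2) (Fin 2) (w.1.adicCompletion L))) a b) ≤ Valued.v ((ϖ : (w.1.adicCompletion L)) ^ (2 * j)))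
    (fun Y hY a b => ?_) (fun k hk hkU Y hY => ?_)
    (fun B : Submodule (Valued.integer (w.1.adicCompletion L)) (Fin 2 → (w.1.adicCompletion L)) =>
      B.map ((Matrix.toLin' ((((((localNonsplitEquiv (IsCMField.complexConj L) (Matrix.of fun i j : Fin 2 => if i.val + j.val + 1 = 2 then (1 : L) else 0) (IsCMField.complexConj_ne_one L) w hw) (γ₂) : ↥(unitaryGroupOfForm (galAdicCompletionMap (L := L) (IsCMField.complexConj L) hw) (placeForm (Matrix.of fun i j : Fin 2 => if i.val + j.val + 1 = 2 then (1 : L) else 0) w.1))) : GL (Fin 2) (w.1.adicCompletion L)) : Matrix (Fin 2) (Fin 2) (w.1.adicCompletion L))) - ((((((localNonsplitEquiv (IsCMField.complexConj L) (Matrix.of fun i j : Fin 2 => if i.val + j.val + 1 = 2 then (1 : L) else 0) (IsCMField.complexConj_ne_one L) w hw) (γ₂) : ↥(unitaryGroupOfForm (galAdicCompletionMap (L := L) (IsCMField.complexConj L) hw) (placeForm (Matrix.of fun i j : Fin 2 => if i.val + j.val + 1 = 2 then (1 : L) else 0) w.1))) : GL (Fin 2) (w.1.adicCompletion L)) : Matrix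 (Fin 2) (Fin 2) (w.1.adicCompletion L))).trace / 2) • (1 : Matrix (Fin 2) (Fin 2) (w.1.adicCompletion L)))).restrictScalars (Valued.integer (w.1.adicCompletion L))) ≤ UnitaryLatticeTree.scaleLattice ((ϖ : (w.1.adicCompletion L)) ^ (2 * j)) B)
    (fun u hu hug => ?_)
  · -- integrality
    have e : Y a b = (Y - ((((((localNonsplitEquiv (IsCMField.complexConj L) (Matrix.of fun i j : Fin 2 => if i.val + j.val + 1 = 2 then (1 : L) else 0) (IsCMField.complexConj_ne_one L) w hw) (γ₂) : ↥(unitaryGroupOfForm (galAdicCompletionMap (L := L) (IsCMField.complexConj L) hw) (placeForm (Matrix.of fun i j : Fin 2 => if i.val + j.val + 1 = 2 then (1 : L) else 0) w.1))) : GL (Fin 2) (w.1.adicCompletion L)) : Matrix (Fin 2) (Fin 2) (w.1.adicCompletion L))).trace / 2) • (1 : Matrix (Fin 2) (Fin 2) (w.1.adicCompletion L))) a b + ((((((localNonsplitEquiv (IsCMField.complexConj L) (Matrix.of fun i j : Fin 2 => if i.val + j.val + 1 = 2 then (1 : L) else 0) (IsCMField.complexConj_ne_one L) w hw) (γ₂)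 : ↥(unitaryGroupOfForm (galAdicCompletionMap (L := L) (IsCMField.complexConj L) hw) (placeForm (Matrix.of fun i j : Fin 2 => if i.val + j.val + 1 = 2 then (1 : L) else 0) w.1))) : GL (Fin 2) (w.1.adicCompletion L)) : Matrix (Fin 2) (Fin 2) (w.1.adicCompletion L))).trace / 2) * (1 : Matrix (Fin 2) (Fin 2) (w.1.adicCompletion L)) a b := by
      simp only [Matrix.sub_apply, Matrix.smul_apply, smul_eq_mul]; ring
    rw [e]
    refine le_trans (Valuation.map_add _ _ _) (max_le (le_trans (hY a b) ?_) ?_)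
    · rw [map_pow]; exact pow_le_one₀ zero_le hϖ1
    · rw [map_mul]
      by_cases hab : a = b
      · rw [hab, Matrix.one_apply_eq, map_one, mul_one]; exact hc1
      · rw [Matrix.one_apply_ne hab, map_zero, mul_zero]; exact zero_le
  · -- `K_U`-conjugation stability
    have hkk' : ((k⁻¹ : GL (Fin 2) (w.1.adicCompletion L)) : Matrix (Fin 2) (Fin 2) (w.1.adicCompletion L)) * ((k⁻¹⁻¹ : GL (Fin 2) (w.1.adicCompletion L)) : Matrix (Fin 2) (Fin 2) (w.1.adicCompletion L)) = 1 := by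
      rw [← Units.val_mul, mul_inv_cancel, Units.val_one]
    have hk'k : ((k⁻¹⁻¹ : GL (Fin 2) (w.1.adicCompletion L)) : Matrix (Fin 2) (Fin 2) (w.1.adicCompletion L)) * ((k⁻¹ : GL (Fin 2) (w.1.adicCompletion L)) : Matrix (Fin 2) (Fin 2) (w.1.adicCompletion L)) = 1 := by
      rw [← Units.val_mul, inv_mul_cancel, Units.val_one]
    have hki := ((HermitianLatticeTree.mem_glInt_iff_forall_v_le_one_and_v_det_eq_one k⁻¹).1 (inv_mem hk)).1
    have hk'i := ((HermitianLatticeTree.mem_glInt_iff_forall_v_le_one_and_v_det_eq_one k⁻¹⁻¹).1 (inv_mem (inv_mem hk))).1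
    have h := (forall_v_conj_sub_smul_one_le_iff w.1 hkk' hk'k hki hk'i _ Y (Valued.v ((ϖ : (w.1.adicCompletion L)) ^ (2 * j)))).2 hY
    rwa [inv_inv] at h
  · -- token translation
    rw [map_toLin'_mapGL_stdLattice_le_scaleLattice_iff (pow_ne_zero _ hϖ0), conj_sub_smul_one_eq]

include hw in
/-- **W-SIDE CENTRED BALL COUNT, EVEN DEPTH `2n`, `j < n`**: `#{B ∣ SD, ΓB = B, (Γ − c·1)B ⊆ ϖ^{2j}B} = (q+1)·Σ_(k<n−j) q^k` (★ II). [cite: LabesseLanglands1979, §2 Lemma 2.1 p. 8] [cite: Rogawski1990, §4.9 p. 56] -/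
theorem ncard_selfDual_fixed_ball_of_even_depth_ramified (he : v.asIdeal.ramificationIdx' w.1.asIdeal ≠ 1) (h2 : IsUnit (2 : 𝒪[(w.1.adicCompletion L)]))
    (ϖ : (w.1.adicCompletion L)ˣ) (hϖ : Valued.v (ϖ : (w.1.adicCompletion L)) = WithZero.exp (-1 : ℤ))
    (hσϖ : (galAdicCompletionMap (L := L) (IsCMField.complexConj L) hw) (ϖ : (w.1.adicCompletion L)) = -(ϖ : (w.1.adicCompletion L))) (γ₂ : ((cmDatum L 2 (Matrix.of fun i j : Fin 2 => if i.val + j.val + 1 = 2 then (1 : L) else 0)).Local v))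
    (hirr : ¬ ∃ x : (w.1.adicCompletion L), ((((((localNonsplitEquiv (IsCMField.complexConj L) (Matrix.of fun i j : Fin 2 => if i.val + j.val + 1 = 2 then (1 : L) else 0) (IsCMField.complexConj_ne_one L) w hw) (γ₂) : ↥(unitaryGroupOfForm (galAdicCompletionMap (L := L) (IsCMField.complexConj L) hw) (placeForm (Matrix.of fun i j : Fin 2 => if i.val + j.val + 1 = 2 then (1 : L) else 0) w.1))) : GL (Fin 2) (w.1.adicCompletion L)) : Matrix (Fin 2) (Fin 2) (w.1.adicCompletion L))).charpoly).IsRoot x)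
    (h2deep : ∀ i j : Fin 2, Valued.v ((((((localNonsplitEquiv (IsCMField.complexConj L) (Matrix.of fun i j : Fin 2 => if i.val + j.val + 1 = 2 then (1 : L) else 0) (IsCMField.complexConj_ne_one L) w hw) (γ₂) : ↥(unitaryGroupOfForm (galAdicCompletionMap (L := L) (IsCMField.complexConj L) hw) (placeForm (Matrix.of fun i j : Fin 2 => if i.val + j.val + 1 = 2 then (1 : L) else 0) w.1))) : GL (Fin 2) (w.1.adicCompletion L)) : Matrix (Fin 2) (Fin 2) (w.1.adicCompletion L)) - 1) i j) ≤ Valued.v ((ϖ : (w.1.adicCompletion L)) ^ 2))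
    {n : ℕ} (hN : Valued.v ((((((localNonsplitEquiv (IsCMField.complexConj L) (Matrix.of fun i j : Fin 2 => if i.val + j.val + 1 = 2 then (1 : L) else 0) (IsCMField.complexConj_ne_one L) w hw) (γ₂) : ↥(unitaryGroupOfForm (galAdicCompletionMap (L := L) (IsCMField.complexConj L) hw) (placeForm (Matrix.of fun i j : Fin 2 => if i.val + j.val + 1 = 2 then (1 : L) else 0) w.1))) : GL (Fin 2) (w.1.adicCompletion L)) : Matrix (Fin 2) (Fin 2) (w.1.adicCompletion L))).trace ^ 2 - 4 * (((((localNonsplitEquiv (IsCMField.complexConj L) (Matrix.of fun i j : Fin 2 => if i.val + j.val + 1 = 2 then (1 : L) else 0) (IsCMField.complexConj_ne_one L) w hw) (γ₂) : ↥(unitaryGroupOfForm (galAdicCompletionMap (L := L) (IsCMField.complexConj L) hw) (placeForm (Matrix.of fun i j : Fin 2 => if i.val + j.val + 1 = 2 then (1 : L) else 0) w.1))) : GL (Fin 2) (w.1.adicCompletion L)) : Matrix (Fin 2) (Fin 2) (w.1.adicCompletion L))).det) = WithZero.exp (-((2 * (2 * n) : ℕ) : ℤ))) {j : ℕ} (hj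 : j < n) :
    {B : Submodule (Valued.integer (w.1.adicCompletion L)) (Fin 2 → (w.1.adicCompletion L)) | UnitaryLatticeTree.IsSelfDualLattice (galAdicCompletionMap (L := L) (IsCMField.complexConj L) hw) (ϖ : (w.1.adicCompletion L)) (!![(0 : (w.1.adicCompletion L)), 1; 1, 0] : Matrix (Fin 2) (Fin 2) (w.1.adicCompletion L)) B ∧
        UnitaryLatticeTree.mapGL ((((localNonsplitEquiv (IsCMField.complexConj L) (Matrix.of fun i j : Fin 2 => if i.val + j.val + 1 = 2 then (1 : L) else 0) (IsCMField.complexConj_ne_one L) w hw) (γ₂) : ↥(unitaryGroupOfForm (galAdicCompletionMap (L := L) (IsCMField.complexConj L) hw) (placeForm (Matrix.of fun i j : Fin 2 => if i.val + j.val + 1 = 2 then (1 : L) else 0) w.1))) : GL (Fin 2) (w.1.adicCompletion L))) B = B ∧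
        B.map ((Matrix.toLin' ((((((localNonsplitEquiv (IsCMField.complexConj L) (Matrix.of fun i j : Fin 2 => if i.val + j.val + 1 = 2 then (1 : L) else 0) (IsCMField.complexConj_ne_one L) w hw) (γ₂) : ↥(unitaryGroupOfForm (galAdicCompletionMap (L := L) (IsCMField.complexConj L) hw) (placeForm (Matrix.of fun i j : Fin 2 => if i.val + j.val + 1 = 2 then (1 : L) else 0) w.1))) : GL (Fin 2) (w.1.adicCompletion L)) : Matrix (Fin 2) (Fin 2) (w.1.adicCompletion L))) - ((((((localNonsplitEquiv (IsCMField.complexConj L) (Matrix.of fun i j : Fin 2 => if i.val + j.val + 1 = 2 then (1 : L) else 0) (IsCMField.complexConj_ne_one L) w hw) (γ₂) : ↥(unitaryGroupOfForm (galAdicCompletionMap (L := L) (IsCMField.complexConj L) hw) (placeForm (Matrix.of fun i j : Fin 2 => if i.val + j.val + 1 = 2 then (1 : L) else 0) w.1))) : GL (Fin 2) (w.1.adicCompletion L)) : Matrix (Fin 2) (Fin 2) (w.1.adicCompletion L))).trace / 2) • (1 : Matrix (Fin 2) (Fin 2) (w.1.adicCompletion L)))).restrictScalars (Valued.integer (w.1.adicCompletion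 L))) ≤ UnitaryLatticeTree.scaleLattice ((ϖ : (w.1.adicCompletion L)) ^ (2 * j)) B}.ncard =
      (Nat.card (𝓞 ↥(maximalRealSubfield L) ⧸ v.asIdeal) + 1) * ∑ k ∈ Finset.range (n - j), Nat.card (𝓞 ↥(maximalRealSubfield L) ⧸ v.asIdeal) ^ k := by
  obtain ⟨C', hC's⟩ := exists_subgroup_forall_mem_iff_sharp L v w hw (ϖ : (w.1.adicCompletion L)) hϖ
  obtain ⟨hC'c, hC'o⟩ := isCompact_and_isOpen_of_forall_mem_iff_sharp L v w hw (ϖ : (w.1.adicCompletion L)) hϖ C' hC's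
  have hC' : ∀ g : ((cmDatum L 2 (Matrix.of fun i j : Fin 2 => if i.val + j.val + 1 = 2 then (1 : L) else 0)).Local v), g ∈ C' ↔ (((localNonsplitEquiv (IsCMField.complexConj L) (Matrix.of fun i j : Fin 2 => if i.val + j.val + 1 = 2 then (1 : L) else 0) (IsCMField.complexConj_ne_one L) w hw) (g) : ↥(unitaryGroupOfForm (galAdicCompletionMap (L := L) (IsCMField.complexConj L) hw) (placeForm (Matrix.of fun i j : Fin 2 => if i.val + j.val + 1 = 2 then (1 : L) else 0) w.1))) : GL (Fin 2) (w.1.adicCompletion L)) ∈ (glInt 2 (w.1.adicCompletion L)).map (MulAut.conj (glDiagonal 2 (w.1.adicCompletion L) ![1, ϖ])).toMonoidHom :=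
    fun g => (hC's g).trans (forall_v_sharp_iff_coe_mem_map_conj L w hw ϖ ((localNonsplitEquiv (IsCMField.complexConj L) (Matrix.of fun i j : Fin 2 => if i.val + j.val + 1 = 2 then (1 : L) else 0) (IsCMField.complexConj_ne_one L) w hw) g))
  rw [ncard_selfDual_fixed_ball_eq_natCard_depth L v w hw he h2 ϖ hϖ γ₂ h2deep]
  exact (natCard_depthFixed_selfDual_and_modular_of_even_depth_ramified L v w hw he h2 ϖ hϖ hσϖ C' hC' hC'o hC'c γ₂ hirr hN hj).1

include hw in
/-- **W-SIDE CENTRED BALL, EVEN DEPTH, TOP `j = n`**: the family is EMPTY in size (`= 0`; ★ IV). [cite: LabesseLanglands1979, §2 Lemma 2.1 p. 8] [cite: Rogawski1990, §4.9 p. 56] -/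
theorem ncard_selfDual_fixed_ball_top_of_even_depth_ramified (he : v.asIdeal.ramificationIdx' w.1.asIdeal ≠ 1) (h2 : IsUnit (2 : 𝒪[(w.1.adicCompletion L)]))
    (ϖ : (w.1.adicCompletion L)ˣ) (hϖ : Valued.v (ϖ : (w.1.adicCompletion L)) = WithZero.exp (-1 : ℤ))
    (hσϖ : (galAdicCompletionMap (L := L) (IsCMField.complexConj L) hw) (ϖ : (w.1.adicCompletion L)) = -(ϖ : (w.1.adicCompletion L))) (γ₂ : ((cmDatum L 2 (Matrix.of fun i j : Fin 2 => if i.val + j.val + 1 = 2 then (1 : L) else 0)).Local v))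
    (hirr : ¬ ∃ x : (w.1.adicCompletion L), ((((((localNonsplitEquiv (IsCMField.complexConj L) (Matrix.of fun i j : Fin 2 => if i.val + j.val + 1 = 2 then (1 : L) else 0) (IsCMField.complexConj_ne_one L) w hw) (γ₂) : ↥(unitaryGroupOfForm (galAdicCompletionMap (L := L) (IsCMField.complexConj L) hw) (placeForm (Matrix.of fun i j : Fin 2 => if i.val + j.val + 1 = 2 then (1 : L) else 0) w.1))) : GL (Fin 2) (w.1.adicCompletion L)) : Matrix (Fin 2) (Fin 2) (w.1.adicCompletion L))).charpoly).IsRoot x)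
    (h2deep : ∀ i j : Fin 2, Valued.v ((((((localNonsplitEquiv (IsCMField.complexConj L) (Matrix.of fun i j : Fin 2 => if i.val + j.val + 1 = 2 then (1 : L) else 0) (IsCMField.complexConj_ne_one L) w hw) (γ₂) : ↥(unitaryGroupOfForm (galAdicCompletionMap (L := L) (IsCMField.complexConj L) hw) (placeForm (Matrix.of fun i j : Fin 2 => if i.val + j.val + 1 = 2 then (1 : L) else 0) w.1))) : GL (Fin 2) (w.1.adicCompletion L)) : Matrix (Fin 2) (Fin 2) (w.1.adicCompletion L)) - 1) i j) ≤ Valued.v ((ϖ : (w.1.adicCompletion L)) ^ 2))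
    {n : ℕ} (hn1 : 1 ≤ n) (hN : Valued.v ((((((localNonsplitEquiv (IsCMField.complexConj L) (Matrix.of fun i j : Fin 2 => if i.val + j.val + 1 = 2 then (1 : L) else 0) (IsCMField.complexConj_ne_one L) w hw) (γ₂) : ↥(unitaryGroupOfForm (galAdicCompletionMap (L := L) (IsCMField.complexConj L) hw) (placeForm (Matrix.of fun i j : Fin 2 => if i.val + j.val + 1 = 2 then (1 : L) else 0) w.1))) : GL (Fin 2) (w.1.adicCompletion L)) : Matrix (Fin 2) (Fin 2) (w.1.adicCompletion L))).trace ^ 2 - 4 * (((((localNonsplitEquiv (IsCMField.complexConj L) (Matrix.of fun i j : Fin 2 => if i.val + j.val + 1 = 2 then (1 : L) else 0) (IsCMField.complexConj_ne_one L) w hw) (γ₂) : ↥(unitaryGroupOfForm (galAdicCompletionMap (L := L) (IsCMField.complexConj L) hw) (placeForm (Matrix.of fun i j : Fin 2 => if i.val + j.val + 1 = 2 then (1 : L) else 0) w.1))) : GL (Fin 2) (w.1.adicCompletion L)) : Matrix (Fin 2) (Fin 2) (w.1.adicCompletion L))).det) = WithZero.exp (-((2 * (2 * n) : ℕ) : ℤ)))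 :
    {B : Submodule (Valued.integer (w.1.adicCompletion L)) (Fin 2 → (w.1.adicCompletion L)) | UnitaryLatticeTree.IsSelfDualLattice (galAdicCompletionMap (L := L) (IsCMField.complexConj L) hw) (ϖ : (w.1.adicCompletion L)) (!![(0 : (w.1.adicCompletion L)), 1; 1, 0] : Matrix (Fin 2) (Fin 2) (w.1.adicCompletion L)) B ∧
        UnitaryLatticeTree.mapGL ((((localNonsplitEquiv (IsCMField.complexConj L) (Matrix.of fun i j : Fin 2 => if i.val + j.val + 1 = 2 then (1 : L) else 0) (IsCMField.complexConj_ne_one L) w hw) (γ₂) : ↥(unitaryGroupOfForm (galAdicCompletionMap (L := L) (IsCMField.complexConj L) hw) (placeForm (Matrix.of fun i j : Fin 2 => if i.val + j.val + 1 = 2 then (1 : L) else 0) w.1))) : GL (Fin 2) (w.1.adicCompletion L))) B = B ∧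
        B.map ((Matrix.toLin' ((((((localNonsplitEquiv (IsCMField.complexConj L) (Matrix.of fun i j : Fin 2 => if i.val + j.val + 1 = 2 then (1 : L) else 0) (IsCMField.complexConj_ne_one L) w hw) (γ₂) : ↥(unitaryGroupOfForm (galAdicCompletionMap (L := L) (IsCMField.complexConj L) hw) (placeForm (Matrix.of fun i j : Fin 2 => if i.val + j.val + 1 = 2 then (1 : L) else 0) w.1))) : GL (Fin 2) (w.1.adicCompletion L)) : Matrix (Fin 2) (Fin 2) (w.1.adicCompletion L))) - ((((((localNonsplitEquiv (IsCMField.complexConj L) (Matrix.of fun i j : Fin 2 => if i.val + j.val + 1 = 2 then (1 : L) else 0) (IsCMField.complexConj_ne_one L) w hw) (γ₂) : ↥(unitaryGroupOfForm (galAdicCompletionMap (L := L) (IsCMField.complexConj L) hw) (placeForm (Matrix.of fun i j : Fin 2 => if i.val + j.val + 1 = 2 then (1 : L) else 0) w.1))) : GL (Fin 2) (w.1.adicCompletion L)) : Matrix (Fin 2) (Fin 2) (w.1.adicCompletion L))).trace / 2) • (1 : Matrix (Fin 2) (Fin 2) (w.1.adicCompletion L)))).restrictScalars (Valued.integer (w.1.adicCompletion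 L))) ≤ UnitaryLatticeTree.scaleLattice ((ϖ : (w.1.adicCompletion L)) ^ (2 * n)) B}.ncard = 0 := by
  rw [ncard_selfDual_fixed_ball_eq_natCard_depth L v w hw he h2 ϖ hϖ γ₂ h2deep n,
    depthFixed_selfDual_top_eq_empty_of_even_depth_ramified L v w hw he h2 ϖ hϖ hσϖ γ₂ hirr hn1 hN]
  simp

include hw in
/-- **W-SIDE CENTRED BALL COUNT, ODD DEPTH `2n+1`, `j ≤ n`**: `#{…} + 1 = 2·Σ_(k<n−j+1) q^k` (★ III, an edge ball). [cite: LabesseLanglands1979, §2 Lemma 2.1 p. 8] [cite: Rogawski1990, §4.9 p. 56] -/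
theorem ncard_selfDual_fixed_ball_of_odd_depth_ramified (he : v.asIdeal.ramificationIdx' w.1.asIdeal ≠ 1) (h2 : IsUnit (2 : 𝒪[(w.1.adicCompletion L)]))
    (ϖ : (w.1.adicCompletion L)ˣ) (hϖ : Valued.v (ϖ : (w.1.adicCompletion L)) = WithZero.exp (-1 : ℤ))
    (hσϖ : (galAdicCompletionMap (L := L) (IsCMField.complexConj L) hw) (ϖ : (w.1.adicCompletion L)) = -(ϖ : (w.1.adicCompletion L))) (γ₂ : ((cmDatum L 2 (Matrix.of fun i j : Fin 2 => if i.val + j.val + 1 = 2 then (1 : L) else 0)).Local v))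
    (hirr : ¬ ∃ x : (w.1.adicCompletion L), ((((((localNonsplitEquiv (IsCMField.complexConj L) (Matrix.of fun i j : Fin 2 => if i.val + j.val + 1 = 2 then (1 : L) else 0) (IsCMField.complexConj_ne_one L) w hw) (γ₂) : ↥(unitaryGroupOfForm (galAdicCompletionMap (L := L) (IsCMField.complexConj L) hw) (placeForm (Matrix.of fun i j : Fin 2 => if i.val + j.val + 1 = 2 then (1 : L) else 0) w.1))) : GL (Fin 2) (w.1.adicCompletion L)) : Matrix (Fin 2) (Fin 2) (w.1.adicCompletion L))).charpoly).IsRoot x)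
    (h2deep : ∀ i j : Fin 2, Valued.v ((((((localNonsplitEquiv (IsCMField.complexConj L) (Matrix.of fun i j : Fin 2 => if i.val + j.val + 1 = 2 then (1 : L) else 0) (IsCMField.complexConj_ne_one L) w hw) (γ₂) : ↥(unitaryGroupOfForm (galAdicCompletionMap (L := L) (IsCMField.complexConj L) hw) (placeForm (Matrix.of fun i j : Fin 2 => if i.val + j.val + 1 = 2 then (1 : L) else 0) w.1))) : GL (Fin 2) (w.1.adicCompletion L)) : Matrix (Fin 2) (Fin 2) (w.1.adicCompletion L)) - 1) i j) ≤ Valued.v ((ϖ : (w.1.adicCompletion L)) ^ 2))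
    {n : ℕ} (hN : Valued.v ((((((localNonsplitEquiv (IsCMField.complexConj L) (Matrix.of fun i j : Fin 2 => if i.val + j.val + 1 = 2 then (1 : L) else 0) (IsCMField.complexConj_ne_one L) w hw) (γ₂) : ↥(unitaryGroupOfForm (galAdicCompletionMap (L := L) (IsCMField.complexConj L) hw) (placeForm (Matrix.of fun i j : Fin 2 => if i.val + j.val + 1 = 2 then (1 : L) else 0) w.1))) : GL (Fin 2) (w.1.adicCompletion L)) : Matrix (Fin 2) (Fin 2) (w.1.adicCompletion L))).trace ^ 2 - 4 * (((((localNonsplitEquiv (IsCMField.complexConj L) (Matrix.of fun i j : Fin 2 => if i.val + j.val + 1 = 2 then (1 : L) else 0) (IsCMField.complexConj_ne_one L) w hw) (γ₂) : ↥(unitaryGroupOfForm (galAdicCompletionMap (L := L) (IsCMField.complexConj L) hw) (placeForm (Matrix.of fun i j : Fin 2 => if i.val + j.val + 1 = 2 then (1 : L) else 0) w.1))) : GL (Fin 2) (w.1.adicCompletion L)) : Matrix (Fin 2) (Fin 2) (w.1.adicCompletion L))).det) = WithZero.exp (-((2 * (2 * n + 1) : ℕ) : ℤ))) {j : ℕ}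 (hjn : j ≤ n) :
    {B : Submodule (Valued.integer (w.1.adicCompletion L)) (Fin 2 → (w.1.adicCompletion L)) | UnitaryLatticeTree.IsSelfDualLattice (galAdicCompletionMap (L := L) (IsCMField.complexConj L) hw) (ϖ : (w.1.adicCompletion L)) (!![(0 : (w.1.adicCompletion L)), 1; 1, 0] : Matrix (Fin 2) (Fin 2) (w.1.adicCompletion L)) B ∧
        UnitaryLatticeTree.mapGL ((((localNonsplitEquiv (IsCMField.complexConj L) (Matrix.of fun i j : Fin 2 => if i.val + j.val + 1 = 2 then (1 : L) else 0) (IsCMField.complexConj_ne_one L) w hw) (γ₂) : ↥(unitaryGroupOfForm (galAdicCompletionMap (L := L) (IsCMField.complexConj L) hw) (placeForm (Matrix.of fun i j : Fin 2 => if i.val + j.val + 1 = 2 then (1 : L) else 0) w.1))) : GL (Fin 2) (w.1.adicCompletion L))) B = B ∧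
        B.map ((Matrix.toLin' ((((((localNonsplitEquiv (IsCMField.complexConj L) (Matrix.of fun i j : Fin 2 => if i.val + j.val + 1 = 2 then (1 : L) else 0) (IsCMField.complexConj_ne_one L) w hw) (γ₂) : ↥(unitaryGroupOfForm (galAdicCompletionMap (L := L) (IsCMField.complexConj L) hw) (placeForm (Matrix.of fun i j : Fin 2 => if i.val + j.val + 1 = 2 then (1 : L) else 0) w.1))) : GL (Fin 2) (w.1.adicCompletion L)) : Matrix (Fin 2) (Fin 2) (w.1.adicCompletion L))) - ((((((localNonsplitEquiv (IsCMField.complexConj L) (Matrix.of fun i j : Fin 2 => if i.val + j.val + 1 = 2 then (1 : L) else 0) (IsCMField.complexConj_ne_one L) w hw) (γ₂) : ↥(unitaryGroupOfForm (galAdicCompletionMap (L := L) (IsCMField.complexConj L) hw) (placeForm (Matrix.of fun i j : Fin 2 => if i.val + j.val + 1 = 2 then (1 : L) else 0) w.1))) : GL (Fin 2) (w.1.adicCompletion L)) : Matrix (Fin 2) (Fin 2) (w.1.adicCompletion L))).trace / 2) • (1 : Matrix (Fin 2) (Fin 2) (w.1.adicCompletion L)))).restrictScalars (Valued.integer (w.1.adicCompletion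 L))) ≤ UnitaryLatticeTree.scaleLattice ((ϖ : (w.1.adicCompletion L)) ^ (2 * j)) B}.ncard + 1 =
      2 * ∑ k ∈ Finset.range (n - j + 1), Nat.card (𝓞 ↥(maximalRealSubfield L) ⧸ v.asIdeal) ^ k := by
  obtain ⟨C', hC's⟩ := exists_subgroup_forall_mem_iff_sharp L v w hw (ϖ : (w.1.adicCompletion L)) hϖ
  obtain ⟨hC'c, hC'o⟩ := isCompact_and_isOpen_of_forall_mem_iff_sharp L v w hw (ϖ : (w.1.adicCompletion L)) hϖ C' hC's
  have hC' : ∀ g : ((cmDatum L 2 (Matrix.of fun i j : Fin 2 => if i.val + j.val + 1 = 2 then (1 : L) else 0)).Local v), g ∈ C' ↔ (((localNonsplitEquiv (IsCMField.complexConj L) (Matrix.of fun i j : Fin 2 => if i.val + j.val + 1 = 2 then (1 : L) else 0) (IsCMField.complexConj_ne_one L) w hw) (g) : ↥(unitaryGroupOfForm (galAdicCompletionMap (L := L) (IsCMField.complexConj L) hw) (placeForm (Matrix.of fun i j : Fin 2 => if i.val + j.val + 1 = 2 then (1 : L) else 0) w.1))) : GL (Fin 2) (w.1.adicCompletion L))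 ∈ (glInt 2 (w.1.adicCompletion L)).map (MulAut.conj (glDiagonal 2 (w.1.adicCompletion L) ![1, ϖ])).toMonoidHom :=
    fun g => (hC's g).trans (forall_v_sharp_iff_coe_mem_map_conj L w hw ϖ ((localNonsplitEquiv (IsCMField.complexConj L) (Matrix.of fun i j : Fin 2 => if i.val + j.val + 1 = 2 then (1 : L) else 0) (IsCMField.complexConj_ne_one L) w hw) g))
  rw [ncard_selfDual_fixed_ball_eq_natCard_depth L v w hw he h2 ϖ hϖ γ₂ h2deep]
  exact (natCard_depthFixed_selfDual_and_modular_of_odd_depth_ramified L v w hw he h2 ϖ hϖ hσϖ C' hC' hC'o hC'c γ₂ hirr hN hjn).1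

/-! ## §2 Odd scales collapse -/

set_option maxHeartbeats 800000 in
include hw in
/-- **ODD SCALES ARE FREE**: for a 2-deep type-(2) `Γ ∈ U(σ_w, Φ₂)` of discriminant depth `N ≠ 2j`, the centred level families at scales `ϖ^{2j+1}` and `ϖ^{2j}` COINCIDE
(★ `depth_collapse_of_twoDeep` on `B = u𝒪_w²`). [cite: LabesseLanglands1979, §2 Lemma 2.1 p. 8] [cite: Kottwitz1986, §3] -/
theorem selfDual_fixed_ball_odd_scale_eq (he : v.asIdeal.ramificationIdx' w.1.asIdeal ≠ 1) (h2 : IsUnit (2 : 𝒪[(w.1.adicCompletion L)]))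
    (ϖ : (w.1.adicCompletion L)ˣ) (hϖ : Valued.v (ϖ : (w.1.adicCompletion L)) = WithZero.exp (-1 : ℤ))
    (hσϖ : (galAdicCompletionMap (L := L) (IsCMField.complexConj L) hw) (ϖ : (w.1.adicCompletion L)) = -(ϖ : (w.1.adicCompletion L))) {ϖ' : (w.1.adicCompletion L)}
    (Γ : GL (Fin 2) (w.1.adicCompletion L)) (hΓ : Γ ∈ unitaryGroupOfForm (galAdicCompletionMap (L := L) (IsCMField.complexConj L) hw) (placeForm (Matrix.of fun i j : Fin 2 => if i.val + j.val + 1 = 2 then (1 : L) else 0) w.1))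
    (h2deep : ∀ i j : Fin 2, Valued.v (((Γ : Matrix (Fin 2) (Fin 2) (w.1.adicCompletion L)) - 1) i j) ≤ Valued.v ((ϖ : (w.1.adicCompletion L)) ^ 2))
    {N : ℕ} (hN : Valued.v ((Γ : Matrix (Fin 2) (Fin 2) (w.1.adicCompletion L)).trace ^ 2 - 4 * (Γ : Matrix (Fin 2) (Fin 2) (w.1.adicCompletion L)).det) = WithZero.exp (-((2 * N : ℕ) : ℤ)))
    {j : ℕ} (hNj : N ≠ 2 * j) :
    {B : Submodule (Valued.integer (w.1.adicCompletion L)) (Fin 2 → (w.1.adicCompletion L)) | UnitaryLatticeTree.IsSelfDualLattice (galAdicCompletionMap (L := L) (IsCMField.complexConj L) hw) ϖ' (!![(0 : (w.1.adicCompletion L)), 1; 1, 0] : Matrix (Fin 2) (Fin 2) (w.1.adicCompletion L)) B ∧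
        UnitaryLatticeTree.mapGL Γ B = B ∧
        B.map ((Matrix.toLin' ((Γ : Matrix (Fin 2) (Fin 2) (w.1.adicCompletion L)) - ((Γ : Matrix (Fin 2) (Fin 2) (w.1.adicCompletion L)).trace / 2) • (1 : Matrix (Fin 2) (Fin 2) (w.1.adicCompletion L)))).restrictScalars (Valued.integer (w.1.adicCompletion L))) ≤ UnitaryLatticeTree.scaleLattice ((ϖ : (w.1.adicCompletion L)) ^ (2 * j + 1)) B} =
    {B : Submodule (Valued.integer (w.1.adicCompletion L)) (Fin 2 → (w.1.adicCompletion L)) | UnitaryLatticeTree.IsSelfDualLattice (galAdicCompletionMap (L := L) (IsCMField.complexConj L) hw) ϖ' (!![(0 : (w.1.adicCompletion L)), 1; 1, 0] : Matrix (Fin 2) (Fin 2) (w.1.adicCompletion L)) B ∧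
        UnitaryLatticeTree.mapGL Γ B = B ∧
        B.map ((Matrix.toLin' ((Γ : Matrix (Fin 2) (Fin 2) (w.1.adicCompletion L)) - ((Γ : Matrix (Fin 2) (Fin 2) (w.1.adicCompletion L)).trace / 2) • (1 : Matrix (Fin 2) (Fin 2) (w.1.adicCompletion L)))).restrictScalars (Valued.integer (w.1.adicCompletion L))) ≤ UnitaryLatticeTree.scaleLattice ((ϖ : (w.1.adicCompletion L)) ^ (2 * j)) B} := by
  have hϖ0 : (ϖ : (w.1.adicCompletion L)) ≠ 0 := ϖ.ne_zero
  have hϖ1 : Valued.v (ϖ : (w.1.adicCompletion L)) ≤ 1 := by rw [hϖ, ← WithZero.exp_zero]; exact WithZero.exp_le_exp.2 (by norm_num)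
  have hUeq : unitaryGroupOfForm (galAdicCompletionMap (L := L) (IsCMField.complexConj L) hw) (placeForm (Matrix.of fun i j : Fin 2 => if i.val + j.val + 1 = 2 then (1 : L) else 0) w.1) = unitaryGroupOfForm (galAdicCompletionMap (L := L) (IsCMField.complexConj L) hw) (!![(0 : (w.1.adicCompletion L)), 1; 1, 0] : Matrix (Fin 2) (Fin 2) (w.1.adicCompletion L)) := by
    rw [unitaryGroupOfForm_placeForm_antidiagTwo_eq]
  ext B
  simp only [Set.mem_setOf_eq]
  refine ⟨fun ⟨hsd, hfix, hle⟩ => ⟨hsd, hfix, ?_⟩, fun ⟨hsd, hfix, hle⟩ => ⟨hsd, hfix, ?_⟩⟩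
  · -- scale `ϖ^(2j+1)` is finer than `ϖ^(2j)`
    obtain ⟨u, rfl⟩ := exists_unitary_mapGL_stdLattice_eq_of_isSelfDualLattice_two L v w hw he h2 _ hsd
    rw [map_toLin'_mapGL_stdLattice_le_scaleLattice_iff (pow_ne_zero _ hϖ0), conj_sub_smul_one_eq] at hle ⊢
    intro a b
    refine le_trans (hle a b) ?_
    rw [map_pow, map_pow, pow_succ]; exact mul_le_of_le_one_right zero_le hϖ1
  · obtain ⟨u, rfl⟩ := exists_unitary_mapGL_stdLattice_eq_of_isSelfDualLattice_two L v w hw he h2 _ hsd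
    rw [map_toLin'_mapGL_stdLattice_le_scaleLattice_iff (pow_ne_zero _ hϖ0), conj_sub_smul_one_eq] at hle ⊢
    exact (depth_collapse_of_twoDeep L v w hw he h2 ϖ hϖ hσϖ Γ (u : GL (Fin 2) (w.1.adicCompletion L)) hΓ (by rw [hUeq]; exact u.2) h2deep hN hNj hle).2

/-! ## §3 The `LEV(ϖ^k)` dichotomy for the uncentred token -/

set_option maxHeartbeats 800000 in
include hw in
/-- **`LEV(ϖ^k)` = THE CENTRED FAMILY when `|½trΓ − 1| ≤ |ϖ^k|`** (`Γ − 1 = (Γ − c·1) + (c − 1)·1`, ultrametric). [cite: Kottwitz1986, §3] [cite: LabesseLanglands1979, §2 p. 8] -/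
theorem selfDual_fixed_lev_eq_ball_of_le (he : v.asIdeal.ramificationIdx' w.1.asIdeal ≠ 1) (h2 : IsUnit (2 : 𝒪[(w.1.adicCompletion L)]))
    (ϖ : (w.1.adicCompletion L)ˣ) {ϖ' : (w.1.adicCompletion L)} (Γ : GL (Fin 2) (w.1.adicCompletion L)) (k : ℕ)
    (hck : Valued.v ((Γ : Matrix (Fin 2) (Fin 2) (w.1.adicCompletion L)).trace / 2 - 1) ≤ Valued.v ((ϖ : (w.1.adicCompletion L)) ^ k)) :
    {B : Submodule (Valued.integer (w.1.adicCompletion L)) (Fin 2 → (w.1.adicCompletion L)) | UnitaryLatticeTree.IsSelfDualLattice (galAdicCompletionMap (L := L) (IsCMField.complexConj L) hw) ϖ' (!![(0 : (w.1.adicCompletion L)), 1; 1, 0] : Matrix (Fin 2) (Fin 2) (w.1.adicCompletion L)) B ∧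
        UnitaryLatticeTree.mapGL Γ B = B ∧
        B.map ((Matrix.toLin' ((Γ : Matrix (Fin 2) (Fin 2) (w.1.adicCompletion L)) - 1)).restrictScalars (Valued.integer (w.1.adicCompletion L))) ≤ UnitaryLatticeTree.scaleLattice ((ϖ : (w.1.adicCompletion L)) ^ k) B} =
    {B : Submodule (Valued.integer (w.1.adicCompletion L)) (Fin 2 → (w.1.adicCompletion L)) | UnitaryLatticeTree.IsSelfDualLattice (galAdicCompletionMap (L := L) (IsCMField.complexConj L) hw) ϖ' (!![(0 : (w.1.adicCompletion L)), 1; 1, 0] : Matrix (Fin 2) (Fin 2) (w.1.adicCompletion L)) B ∧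
        UnitaryLatticeTree.mapGL Γ B = B ∧
        B.map ((Matrix.toLin' ((Γ : Matrix (Fin 2) (Fin 2) (w.1.adicCompletion L)) - ((Γ : Matrix (Fin 2) (Fin 2) (w.1.adicCompletion L)).trace / 2) • (1 : Matrix (Fin 2) (Fin 2) (w.1.adicCompletion L)))).restrictScalars (Valued.integer (w.1.adicCompletion L))) ≤ UnitaryLatticeTree.scaleLattice ((ϖ : (w.1.adicCompletion L)) ^ k) B} := by
  have hϖ0 : (ϖ : (w.1.adicCompletion L)) ≠ 0 := ϖ.ne_zero
  -- entrywise: `|(Y − 1)_{ab}| ≤ r ⟺ |(Y − c1)_{ab}| ≤ r` when `|c − 1| ≤ r`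
  have hent : ∀ Y : Matrix (Fin 2) (Fin 2) (w.1.adicCompletion L), (∀ a b : Fin 2, Valued.v ((Y - 1) a b) ≤ Valued.v ((ϖ : (w.1.adicCompletion L)) ^ k)) ↔
      (∀ a b : Fin 2, Valued.v ((Y - ((Γ : Matrix (Fin 2) (Fin 2) (w.1.adicCompletion L)).trace / 2) • (1 : Matrix (Fin 2) (Fin 2) (w.1.adicCompletion L))) a b) ≤ Valued.v ((ϖ : (w.1.adicCompletion L)) ^ k)) := by
    intro Y
    have hcab : ∀ a b : Fin 2, Valued.v ((((Γ : Matrix (Fin 2) (Fin 2) (w.1.adicCompletion L)).trace / 2) - 1) * (1 : Matrix (Fin 2) (Fin 2) (w.1.adicCompletion L)) a b) ≤ Valued.v ((ϖ : (w.1.adicCompletion L)) ^ k) := by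
      intro a b; rw [map_mul]
      by_cases hab : a = b
      · rw [hab, Matrix.one_apply_eq, map_one, mul_one]; exact hck
      · rw [Matrix.one_apply_ne hab, map_zero, mul_zero]; exact zero_le
    have e : ∀ a b : Fin 2, (Y - ((Γ : Matrix (Fin 2) (Fin 2) (w.1.adicCompletion L)).trace / 2) • (1 : Matrix (Fin 2) (Fin 2) (w.1.adicCompletion L))) a b = (Y - 1) a b - (((Γ : Matrix (Fin 2) (Fin 2) (w.1.adicCompletion L)).trace / 2) - 1) * (1 : Matrix (Fin 2) (Fin 2) (w.1.adicCompletion L)) a b := by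
      intro a b; simp only [Matrix.sub_apply, Matrix.smul_apply, smul_eq_mul]; ring
    have e' : ∀ a b : Fin 2, (Y - 1) a b = (Y - ((Γ : Matrix (Fin 2) (Fin 2) (w.1.adicCompletion L)).trace / 2) • (1 : Matrix (Fin 2) (Fin 2) (w.1.adicCompletion L))) a b + (((Γ : Matrix (Fin 2) (Fin 2) (w.1.adicCompletion L)).trace / 2) - 1) * (1 : Matrix (Fin 2) (Fin 2) (w.1.adicCompletion L)) a b := by
      intro a b; rw [e]; ring
    constructor
    · intro h a b; rw [e]; exact le_trans (Valuation.map_sub _ _ _) (max_le (h a b) (hcab a b))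
    · intro h a b; rw [e']; exact le_trans (Valuation.map_add _ _ _) (max_le (h a b) (hcab a b))
  ext B
  simp only [Set.mem_setOf_eq]
  refine ⟨fun ⟨hsd, hfix, hle⟩ => ⟨hsd, hfix, ?_⟩, fun ⟨hsd, hfix, hle⟩ => ⟨hsd, hfix, ?_⟩⟩
  · obtain ⟨u, rfl⟩ := exists_unitary_mapGL_stdLattice_eq_of_isSelfDualLattice_two L v w hw he h2 _ hsd
    rw [map_toLin'_mapGL_stdLattice_le_scaleLattice_iff (pow_ne_zero _ hϖ0), ← units_coe_inv_mul_mul_sub_one_eq_conj] at hle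
    rw [map_toLin'_mapGL_stdLattice_le_scaleLattice_iff (pow_ne_zero _ hϖ0), conj_sub_smul_one_eq]
    exact (hent _).1 hle
  · obtain ⟨u, rfl⟩ := exists_unitary_mapGL_stdLattice_eq_of_isSelfDualLattice_two L v w hw he h2 _ hsd
    rw [map_toLin'_mapGL_stdLattice_le_scaleLattice_iff (pow_ne_zero _ hϖ0), conj_sub_smul_one_eq] at hle
    rw [map_toLin'_mapGL_stdLattice_le_scaleLattice_iff (pow_ne_zero _ hϖ0), ← units_coe_inv_mul_mul_sub_one_eq_conj]
    exact (hent _).2 hle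

set_option maxHeartbeats 800000 in
include hw in
/-- **`LEV(ϖ^k)` IS EMPTY when `|½trΓ − 1| > |ϖ^k|`** (`|2| = 1`): `Γ − c·1` is traceless, so `2(c − 1) = (Y−1)₀₀ + (Y−1)₁₁` would have to be small. [cite: Kottwitz1986, §3]
[cite: LabesseLanglands1979, §2 p. 8] -/
theorem selfDual_fixed_lev_eq_empty_of_lt (he : v.asIdeal.ramificationIdx' w.1.asIdeal ≠ 1) (h2 : IsUnit (2 : 𝒪[(w.1.adicCompletion L)]))
    (ϖ : (w.1.adicCompletion L)ˣ) {ϖ' : (w.1.adicCompletion L)} (Γ : GL (Fin 2) (w.1.adicCompletion L)) (k : ℕ)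
    (hck : Valued.v ((ϖ : (w.1.adicCompletion L)) ^ k) < Valued.v ((Γ : Matrix (Fin 2) (Fin 2) (w.1.adicCompletion L)).trace / 2 - 1)) :
    {B : Submodule (Valued.integer (w.1.adicCompletion L)) (Fin 2 → (w.1.adicCompletion L)) | UnitaryLatticeTree.IsSelfDualLattice (galAdicCompletionMap (L := L) (IsCMField.complexConj L) hw) ϖ' (!![(0 : (w.1.adicCompletion L)), 1; 1, 0] : Matrix (Fin 2) (Fin 2) (w.1.adicCompletion L)) B ∧
        UnitaryLatticeTree.mapGL Γ B = B ∧
        B.map ((Matrix.toLin' ((Γ : Matrix (Fin 2) (Fin 2) (w.1.adicCompletion L)) - 1)).restrictScalars (Valued.integer (w.1.adicCompletion L))) ≤ UnitaryLatticeTree.scaleLattice ((ϖ : (w.1.adicCompletion L)) ^ k) B} = ∅ := by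
  have hϖ0 : (ϖ : (w.1.adicCompletion L)) ≠ 0 := ϖ.ne_zero
  have h2w : Valued.v (2 : (w.1.adicCompletion L)) = 1 := (isUnit_two_integer_iff_valued_eq_one L w.1).1 h2
  ext B
  simp only [Set.mem_setOf_eq, Set.mem_empty_iff_false, iff_false, not_and]
  intro hsd hfix hle
  obtain ⟨u, rfl⟩ := exists_unitary_mapGL_stdLattice_eq_of_isSelfDualLattice_two L v w hw he h2 _ hsd
  rw [map_toLin'_mapGL_stdLattice_le_scaleLattice_iff (pow_ne_zero _ hϖ0), ← units_coe_inv_mul_mul_sub_one_eq_conj] at hle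
  -- `tr (Y − 1) = tr Γ − 2 = 2(c − 1)` is the sum of two small diagonal entries
  have htr : (((((u : GL (Fin 2) (w.1.adicCompletion L)))⁻¹ * Γ * (u : GL (Fin 2) (w.1.adicCompletion L)) : GL (Fin 2) (w.1.adicCompletion L)) : Matrix (Fin 2) (Fin 2) (w.1.adicCompletion L)) - 1) 0 0 +
      (((((u : GL (Fin 2) (w.1.adicCompletion L)))⁻¹ * Γ * (u : GL (Fin 2) (w.1.adicCompletion L)) : GL (Fin 2) (w.1.adicCompletion L)) : Matrix (Fin 2) (Fin 2) (w.1.adicCompletion L)) - 1) 1 1 = 2 * ((Γ : Matrix (Fin 2) (Fin 2) (w.1.adicCompletion L)).trace / 2 - 1) := by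
    have htrc : ((((u : GL (Fin 2) (w.1.adicCompletion L)))⁻¹ * Γ * (u : GL (Fin 2) (w.1.adicCompletion L)) : GL (Fin 2) (w.1.adicCompletion L)) : Matrix (Fin 2) (Fin 2) (w.1.adicCompletion L)).trace = (Γ : Matrix (Fin 2) (Fin 2) (w.1.adicCompletion L)).trace := by
      rw [Units.val_mul, Units.val_mul]; exact Matrix.trace_units_conj' _ _
    rw [Matrix.trace_fin_two] at htrc
    simp only [Matrix.sub_apply, Matrix.one_apply_eq]
    linear_combination htrc
  have hsmall : Valued.v (2 * ((Γ : Matrix (Fin 2) (Fin 2) (w.1.adicCompletion L)).trace / 2 - 1)) ≤ Valued.v ((ϖ : (w.1.adicCompletion L)) ^ k) := by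
    rw [← htr]; exact le_trans (Valuation.map_add _ _ _) (max_le (hle 0 0) (hle 1 1))
  rw [map_mul, h2w, one_mul] at hsmall
  exact absurd hck (not_lt.2 hsmall)

end Balls

end Literature.NumberTheory.Automorphic.UnitaryGroup

end
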